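import Literature.MathematicalPhysics.QuantumFieldTheory.Balaban1983to89.B9Thm313WholeLeft
import Literature.MathematicalPhysics.QuantumFieldTheory.Balaban1983to89.B9Thm312WholeHHolder

/-!
# `Balaban1983to89.B9Thm313WholeHolder` — [B9] Theorem 3.13 (p. 426): the two (3.43) HÖLDER PROBE MAJORANTS of 𝔊 = 𝔓G₁ at one member and one
# configuration — the reduction (3.153) carried out in the probe classes (left member Φ^Y_β∘∇_U∘𝔊, right member Φ^X_β∘𝔊∘∇\*_U)

T. Bałaban, *Propagators for lattice gauge theories in a background field*, Commun. Math. Phys. **99** (1985) 389–434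
[`Balaban1985BackgroundPropagators`, "B9"]; [4] = T. Bałaban, *Propagators and renormalization transformations for lattice
gauge theories. II*, Commun. Math. Phys. **96** (1984) 223–250 [`Balaban1984PropagatorsII`].

statement-level skeleton of published theorems with citation tags; proofs where landed; nothing here is a claim about the
Yang–Mills mass gap

THE PRINTED LOCI (verbatim).  p. 426: *"The formulas (3.147), (3.153) permit us to reduce properties of the operators 𝔓, 𝔊 to the corresponding
properties of the operators G′, (Q′G′²Q′*)⁻¹, G₁, (QG₁Q*)⁻¹"*; (3.153) p. 426: *"𝔊 = G₁ − G₁DRD*G₁ − G₁Q*(QG₁Q*)⁻¹QG₁ = G₁𝔓* = 𝔓G₁"*; Theorem 3.13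
p. 426: *"Theorems 3.3, 3.10, 3.11 hold for the propagator 𝔊, with the exception of the inequality in (3.42) involving the covariant Laplace
operator"*; (3.43) p. 398.

WHY THIS FILE.  The row-21 leaf `…B9Thm313WholeLeafRelS.thm313Printed_of_stepRelS` displays the Hölder block (3.43)–(3.45) of 𝔊.  The (3.43) line is read
(n06-k `H1ReadsRel`) from the two probe majorants of Φ^Y_β∘∇_U∘𝔊 and Φ^X_β∘𝔊∘∇\*_U; THIS FILE derives both through (3.153), exactly as the sup
entries ∇_U𝔊 (`B9Thm313WholeLeft.GG_entry1_of_letters`) and 𝔊∇\*_U (`B9Thm313Whole.GG_entry2_of_letters`) were derived, with the left letters of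
each term read in the probe classes:
* §1 bookkeeping: `hasMaj_toR_src`, `hasMaj_toR_tgt`, `hasMaj_len_src`, `hasMaj_len_tgt` (state norms with integer ∕ real ∕ length weights),
  `E_GG_eq`, `E_GG_F_eq` ((3.153) with a left factor E and a right factor F), `hasMaj_left_rightR` (E A F = E G₀F + (E G₀T)(A F) over a middle real class).
* §2 the letters `Letters313H 𝔬 𝔭 R₀ H₀ hlen bW BhD Bx δ₃ U` (printed ∕ md shape; nothing asserted): `pYDH` — the Hölder probe of the MIXED entry
  ∇_UG₀D out of the scalar-field Hölder class `bW` (the probe twin of `Letters313D.dgDH`); `pXDv` — the Hölder probe of G₀D from the scalar sup class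
  (the twin of `Letters313.gD1`, species (3.43)₂); `pXQs` — the Hölder probe of G₀Q* from the coarse class Z^{len} (the twin of `Letters313.gQs1`).
* §3 ★ `GG_probe43L_of_letters` (Φ^Y_β∘∇_U∘𝔊 : 𝔠^{(0)} → 𝔠_P^{(β−1)}, constant `constH313 …`, then the [4]-(2.51) shape B(β)(Lʲη)^{1−β}e^{−ρ′d}) and
  ★ `GG_probe43R_of_letters` (Φ^X_β∘𝔊∘∇\*_U : 𝔠_Y^{(0)} → 𝔠_P^{(β−1)}, same shape) — the inputs `hL`, `hRt` of n06-k's `line343_of_hasMajorantHom_rel` for 𝔊.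

HONEST SCOPE.  Nothing of [B9] or [4] is asserted: every letter, step and entry is a HYPOTHESIS of printed ∕ definitional shape (located gap
G-B9-16); the content is bookkeeping of (3.153), kernel-checked.  NOT a node discharge, NOT summit progress; one finite lattice at a time;
nothing continuum, nothing about the mass gap.  Cell `pub-ymgap` (HUMAN RULING D-0062), Track A node N06 [B9], N06-ASSIGNMENT v1 row 21 (bundle
F7), seat `pub-ymgap-dag-n06-l` (g4), 2026-08-27.
-/

namespace Literature.MathematicalPhysics.QuantumFieldTheory.Balaban1983to89.B9Thm313WholeHolder

open Literature.MathematicalPhysics.QuantumFieldTheory.Balaban1983to89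
open Finset B6RandomWalk B6RandomWalkHom B9Thm34Ext B9Thm37GlueCor36 B11SectG B9SectDSup
open B9Thm37AllNorms B9Thm37AllNormsInstances B9Thm312Whole B9Thm312WholeLeaf B9Thm312WholeLeft B9Thm313Whole B9Thm313WholeLeft
open B9RWSums343Holder B9Ineq347 B9Thm312WholeClasses B9Thm312WholeHolder B9Thm312WholeHHolder

noncomputable section

/-! ## §1 Bookkeeping: one-sided class conversions, (3.153) with outer factors, the left-and-right entry over a real middle class -/

section Book

variable {g : B9.Geometry} {B : B9.Backgrounds} {X Y Z W V : Type} [Fintype X] [Fintype V] [Fintype g.Site]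
variable {R₀ : ℝ} {H₀ : Prop}

/-- Source side: `cNorm … q` → 𝔠^{(−q)}. [cite: Balaban1985BackgroundPropagators, (3.42) p.397 (bookkeeping)] -/
theorem hasMaj_toR_src (hG : GeoOK g) {F : Type} [AddCommGroup F] [Module ℝ F] {b : BlockNorm (toB6 g R₀ H₀) F} {blkV : V → g.Site}
    {T : (V → ℝ) →ₗ[ℝ] F} {K : g.Site → g.Site → ℝ} {q : ℕ} (h : HasMaj (cNorm R₀ H₀ blkV hG.lenle q) b T K) :
    HasMaj (cNormR R₀ H₀ blkV hG.lenle (-(q : ℝ))) b T K := by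
  intro y' μ hμ y
  rw [cNormR_loc_neg_natCast hG]
  exact h y' μ hμ y

omit [Fintype V] in
/-- Target side: `cNorm … p` → 𝔠^{(−p)}. [cite: Balaban1985BackgroundPropagators, (3.42) p.397 (bookkeeping)] -/
theorem hasMaj_toR_tgt (hG : GeoOK g) {F : Type} [AddCommGroup F] [Module ℝ F] {b : BlockNorm (toB6 g R₀ H₀) F} {blk : X → g.Site}
    {T : F →ₗ[ℝ] (X → ℝ)} {K : g.Site → g.Site → ℝ} {p : ℕ} (h : HasMaj b (cNorm R₀ H₀ blk hG.lenle p) T K) :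
    HasMaj b (cNormR R₀ H₀ blk hG.lenle (-(p : ℝ))) T K := by
  intro y' μ hμ y
  rw [cNormR_loc_neg_natCast hG]
  exact h y' μ hμ y

/-- Source side: the length-weighted coarse class Z^{len} of `Letters313` is 𝔠_Z^{(1)}. [cite: Balaban1985BackgroundPropagators, (3.42) p.397 (bookkeeping)] -/
theorem hasMaj_len_src (hG : GeoOK g) {F : Type} [AddCommGroup F] [Module ℝ F] {b : BlockNorm (toB6 g R₀ H₀) F} {blkV : V → g.Site}
    {T : (V → ℝ) →ₗ[ℝ] F} {K : g.Site → g.Site → ℝ}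
    (h : HasMaj (weightNorm (BlockNorm.ofBlocks (toB6 g R₀ H₀) blkV) g.len fun y => (hG.lenpos y).le) b T K) :
    HasMaj (cNormR R₀ H₀ blkV hG.lenle 1) b T K := by
  intro y' μ hμ y
  have hb := h y' μ hμ y
  rw [weightNorm_loc] at hb
  rw [cNormR_loc, Real.rpow_one]
  exact hb

omit [Fintype V] in
/-- Target side: Z^{len} is 𝔠_Z^{(1)}. [cite: Balaban1985BackgroundPropagators, (3.42) p.397 (bookkeeping)] -/
theorem hasMaj_len_tgt (hG : GeoOK g) {F : Type} [AddCommGroup F] [Module ℝ F] {b : BlockNorm (toB6 g R₀ H₀) F} {blk : X → g.Site}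
    {T : F →ₗ[ℝ] (X → ℝ)} {K : g.Site → g.Site → ℝ}
    (h : HasMaj b (weightNorm (BlockNorm.ofBlocks (toB6 g R₀ H₀) blk) g.len fun y => (hG.lenpos y).le) T K) :
    HasMaj b (cNormR R₀ H₀ blk hG.lenle 1) T K := by
  intro y' μ hμ y
  have hb := h y' μ hμ y
  rw [weightNorm_loc] at hb
  rw [cNormR_loc, Real.rpow_one]
  exact hb

omit [Fintype V] [Fintype g.Site] in
/-- **(3.153) WITH A LEFT FACTOR E**: E𝔊 = EG₁ − (EG₁D)(RD*G₁) − (EG₁Q*)((QG₁Q*)⁻¹(QG₁)) from 𝔊 = G₁𝔓* (`Identities.eq153`), the E-twin of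
`B9Thm313WholeLeft.D_GG_eq`. [cite: Balaban1985BackgroundPropagators, (3.153) p.426] -/
theorem E_GG_eq [Fintype Z] [Fintype W] {V' : Type} {𝔬 : Ops g B X Y Z W} {U : B.Cfg} (hI : Identities 𝔬 U)
    (E : (X → ℝ) →ₗ[ℝ] (V' → ℝ)) :
    E ∘ₗ 𝔬.GG U =
      E ∘ₗ 𝔬.G1 U ∘ₗ LinearMap.id -
        (E ∘ₗ 𝔬.G1 U ∘ₗ 𝔬.Dv U) ∘ₗ (𝔬.R U ∘ₗ 𝔬.Dvstar U ∘ₗ 𝔬.G1 U ∘ₗ LinearMap.id) -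
        (E ∘ₗ 𝔬.G1 U ∘ₗ 𝔬.Qstar U) ∘ₗ (𝔬.C1 U ∘ₗ (𝔬.Q U ∘ₗ (𝔬.G1 U ∘ₗ LinearMap.id))) := by
  refine LinearMap.ext fun f => ?_
  simp only [LinearMap.comp_apply, LinearMap.sub_apply, LinearMap.id_coe, id_eq, hI.eq153, frakPstar_apply, map_sub]
  abel

omit [Fintype V] [Fintype g.Site] in
/-- **(3.153) WITH A LEFT FACTOR E AND A RIGHT FACTOR F**: E𝔊F = EG₁F − (EG₁D)(RD*G₁F) − (EG₁Q*)((QG₁Q*)⁻¹(Q(G₁F))) (`B9Thm313Whole.GG_comp_eq` composed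
with E). [cite: Balaban1985BackgroundPropagators, (3.153) p.426] -/
theorem E_GG_F_eq [Fintype Z] [Fintype W] {V' V'' : Type} {𝔬 : Ops g B X Y Z W} {U : B.Cfg} (hI : Identities 𝔬 U)
    (E : (X → ℝ) →ₗ[ℝ] (V' → ℝ)) (F : (V'' → ℝ) →ₗ[ℝ] (X → ℝ)) :
    E ∘ₗ (𝔬.GG U ∘ₗ F) =
      E ∘ₗ 𝔬.G1 U ∘ₗ F -
        (E ∘ₗ 𝔬.G1 U ∘ₗ 𝔬.Dv U) ∘ₗ (𝔬.R U ∘ₗ 𝔬.Dvstar U ∘ₗ 𝔬.G1 U ∘ₗ F) -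
        (E ∘ₗ 𝔬.G1 U ∘ₗ 𝔬.Qstar U) ∘ₗ (𝔬.C1 U ∘ₗ (𝔬.Q U ∘ₗ (𝔬.G1 U ∘ₗ F))) := by
  refine LinearMap.ext fun f => ?_
  simp only [LinearMap.comp_apply, LinearMap.sub_apply, hI.eq153, frakPstar_apply, map_sub]
  abel

omit [Fintype V] in
/-- **THE LEFT-AND-RIGHT ENTRY OVER A REAL MIDDLE CLASS** (the probe twin of `B9Thm313WholeLeft.hasMaj_left_right`): E G₀𝒳 : b₀ → b_out (a·e^{−ρ_a d}), the
E-step E G₀T : 𝔠^{(s)} → b_out (θ′e^{−δ_K d}), A𝒳 : b₀ → 𝔠^{(s)} (A′e^{−ρ_A d}) and A = G₀ + G₀TA give E A𝒳 : b₀ → b_out the majorant (a + θ′A′c)e^{−rd} for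
0 ≦ r ≦ min(ρ_a, ρ_A), r + σ ≦ δ_K. [cite: Balaban1985BackgroundPropagators, (3.130) p.421 + (3.138) p.423 + Thm 3.13 p.426; Balaban1984PropagatorsII, Lemma 2.1 p.234] -/
theorem hasMaj_left_rightR {F₀ F₁ : Type} [AddCommGroup F₀] [Module ℝ F₀] [AddCommGroup F₁] [Module ℝ F₁] (hG : GeoOK g)
    {blk : X → g.Site} {b₀ : BlockNorm (toB6 g R₀ H₀) F₀} {bout : BlockNorm (toB6 g R₀ H₀) F₁}
    {G0 T A : Module.End ℝ (X → ℝ)} {E : (X → ℝ) →ₗ[ℝ] F₁} {Fop : F₀ →ₗ[ℝ] (X → ℝ)} {s : ℝ}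
    {θ' a A' δK ρa ρA r σ c : ℝ} (hrow : RowSum (toB6 g R₀ H₀) σ c) (hθ' : 0 ≤ θ') (ha : 0 ≤ a) (hA' : 0 ≤ A')
    (hr : 0 ≤ r) (hra : r ≤ ρa) (hrA : r ≤ ρA) (hrδ : r + σ ≤ δK)
    (hKE : HasMaj (cNormR R₀ H₀ blk hG.lenle s) bout (E ∘ₗ G0 ∘ₗ T) (fun a b => θ' * Real.exp (-(δK * g.dist a b))))
    (hEF : HasMaj b₀ bout (E ∘ₗ G0 ∘ₗ Fop) (fun y y' => a * Real.exp (-(ρa * g.dist y y'))))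
    (hAF : HasMaj b₀ (cNormR R₀ H₀ blk hG.lenle s) (A ∘ₗ Fop) (fun y y' => A' * Real.exp (-(ρA * g.dist y y'))))
    (hfix : A = G0 + G0 ∘ₗ T ∘ₗ A) :
    HasMaj b₀ bout (E ∘ₗ A ∘ₗ Fop) (fun y y' => (a + θ' * A' * c) * Real.exp (-(r * g.dist y y'))) := by
  have htri : Triangle254 (toB6 g R₀ H₀) := fun a b c => hG.tri a b c
  have h2 : HasMaj b₀ bout ((E ∘ₗ G0 ∘ₗ T) ∘ₗ (A ∘ₗ Fop))
      (fun y y' => (cNormR R₀ H₀ blk hG.lenle s (X := X)).κ * θ' * A' * c * Real.exp (-(r * g.dist y y'))) :=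
    hasMaj_comp_exp htri hG.dnn hrow hθ' hA' hr hrA hrδ hKE hAF
  simp only [cNormR_κ, one_mul] at h2
  have hsum := (hEF.of_rate_le hG.dnn ha hra).add h2
  have hop : E ∘ₗ A ∘ₗ Fop = E ∘ₗ G0 ∘ₗ Fop + (E ∘ₗ G0 ∘ₗ T) ∘ₗ (A ∘ₗ Fop) := by
    refine LinearMap.ext fun v => ?_
    have hpt : A (Fop v) = G0 (Fop v) + G0 (T (A (Fop v))) := by
      conv_lhs => rw [hfix]
      simp only [LinearMap.add_apply, LinearMap.comp_apply]
    simp only [LinearMap.comp_apply, LinearMap.add_apply]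
    conv_lhs => rw [hpt]
    rw [map_add]
  rw [← hop] at hsum
  exact hsum.mono fun y y' => le_of_eq (by simp only [toB6_dist]; ring)

end Book

/-! ## §2 The letters of the two (3.43) reductions in the probe classes -/

section Letters

variable {g : B9.Geometry} {B : B9.Backgrounds} {X Y Z W PX PY : Type} [Fintype X] [Fintype Z] [Fintype W] [Fintype PX] [Fintype PY]
  [Fintype g.Site]

/-- **THE LETTERS OF THE (3.43) REDUCTIONS OF 𝔊 AT U** — hypotheses of printed ∕ md shape, nothing asserted: `pYDH β` = the Hölder probe of the MIXED
entry ∇_UG₀D OUT OF the scalar-field Hölder class `bW` (the probe twin of `Letters313D.dgDH`: (3.45)-type for G₀ with the gauge derivative D of [4]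
(2.26) on the right; between pure sup classes this is false, whence `bW`); `pXDv β` = the Hölder probe of G₀D from the scalar sup class W⁰ (the
probe twin of `Letters313.gD1`, species (3.43)₂: *"‖ζG′∇\*_Uλ‖_β ≦ … |λ|"* with D for ∇\*); `pXQs β` = the Hölder probe of G₀Q* from the coarse class
Z^{len} (the probe twin of `Letters313.gQs1`); constants `BhD β`, `Bx β`, rate δ₃.
[cite: Balaban1985BackgroundPropagators, Thm 3.13 p.426 + (3.152)–(3.153) p.426 + (3.43)–(3.45) p.398 + (3.49) p.399; Balaban1984PropagatorsII, (2.26) p.228] -/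
structure Letters313H (𝔬 : Ops g B X Y Z W) (𝔭 : HolderProbes g B X Y PX PY) (R₀ : ℝ) (H₀ : Prop)
    (hlen : ∀ y : g.Site, 0 ≤ g.len y) (bW : BlockNorm (toB6 g R₀ H₀) (W → ℝ)) (BhD Bx : ℝ → ℝ) (δ₃ : ℝ) (U : B.Cfg) : Prop where
  pYDH : ∀ β : ℝ, 0 ≤ β → β < 1 → HasMaj bW (cNormR R₀ H₀ 𝔭.blkPY hlen (β - 1)) ((𝔭.ΦY U β ∘ₗ 𝔬.D U ∘ₗ 𝔬.G0 U) ∘ₗ 𝔬.Dv U)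
    (fun a b => BhD β * Real.exp (-(δ₃ * g.dist a b)))
  pXDv : ∀ β : ℝ, 0 ≤ β → β < 1 → HasMaj (cNormR R₀ H₀ 𝔬.blkW hlen 0) (cNormR R₀ H₀ 𝔭.blkPX hlen (β - 1)) ((𝔭.ΦX U β ∘ₗ 𝔬.G0 U) ∘ₗ 𝔬.Dv U)
    (fun a b => Bx β * Real.exp (-(δ₃ * g.dist a b)))
  pXQs : ∀ β : ℝ, 0 ≤ β → β < 1 → HasMaj (cNormR R₀ H₀ 𝔬.blkZ hlen 1) (cNormR R₀ H₀ 𝔭.blkPX hlen (β - 1)) ((𝔭.ΦX U β ∘ₗ 𝔬.G0 U) ∘ₗ 𝔬.Qstar U)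
    (fun a b => Bx β * Real.exp (-(δ₃ * g.dist a b)))

end Letters

/-! ## §3 One member, one U: the two (3.43) probe majorants of 𝔊 -/

section OneMember

variable {g : B9.Geometry} {B : B9.Backgrounds} {X Y Z W PX PY : Type}
variable [Fintype X] [Fintype Y] [Fintype Z] [Fintype W] [Fintype PX] [Fintype PY] [Fintype g.Site]
variable {R₀ : ℝ} {H₀ : Prop}

/-- The constant of the (3.43) members of 𝔊 as the reduction delivers it (middle sup classes of cutting cost 1, the scalar Hölder class of cost κ_W):
C_L (the G₁ member) + κ_W·B_d·B₃·c + θ′(A₃B₃c)c + B_q(B₃(B₃A₁c)c)c + θ′(A₃(B₃(B₃A₁c)c)c)c — `constD313` with the two head letters' constants B_d, B_q.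
[cite: Balaban1985BackgroundPropagators, Thm 3.13 p.426 (bookkeeping)] -/
def constH313 (CL θ' A₁ A₃ B₃ Bd Bq κW c : ℝ) : ℝ :=
  CL + κW * Bd * B₃ * c + θ' * (A₃ * B₃ * c) * c + Bq * (B₃ * (B₃ * A₁ * c) * c) * c + θ' * (A₃ * (B₃ * (B₃ * A₁ * c) * c) * c) * c

omit [Fintype X] [Fintype Y] [Fintype Z] [Fintype W] [Fintype PX] [Fintype PY] [Fintype g.Site] in
/-- `constH313` is non-negative for non-negative data. [cite: Balaban1985BackgroundPropagators, Thm 3.13 p.426 (bookkeeping)] -/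
theorem constH313_nonneg {CL θ' A₁ A₃ B₃ Bd Bq κW c : ℝ} (hL : 0 ≤ CL) (hθ : 0 ≤ θ') (h₁ : 0 ≤ A₁) (h₃ : 0 ≤ A₃) (hB : 0 ≤ B₃)
    (hd : 0 ≤ Bd) (hq : 0 ≤ Bq) (hκ : 0 ≤ κW) (hc : 0 ≤ c) : 0 ≤ constH313 CL θ' A₁ A₃ B₃ Bd Bq κW c := by
  unfold constH313
  positivity

omit [Fintype X] [Fintype Y] [Fintype Z] [Fintype W] [Fintype PX] [Fintype PY] [Fintype g.Site] in
/-- `constH313` is monotone in (C_L, θ′, A₁, A₃, κ_W) (for non-negative data). [cite: Balaban1985BackgroundPropagators, Thm 3.13 p.426 (bookkeeping)] -/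
theorem constH313_mono {CL CL' θ' θ'' A₁ A₁' A₃ A₃' B₃ Bd Bq κW κW' c : ℝ} (hL' : CL ≤ CL') (hθ : 0 ≤ θ') (hθ'' : θ' ≤ θ'')
    (h₁ : 0 ≤ A₁) (h₁' : A₁ ≤ A₁') (h₃ : 0 ≤ A₃) (h₃' : A₃ ≤ A₃') (hB : 0 ≤ B₃) (hd : 0 ≤ Bd) (hq : 0 ≤ Bq)
    (hκ' : κW ≤ κW') (hc : 0 ≤ c) :
    constH313 CL θ' A₁ A₃ B₃ Bd Bq κW c ≤ constH313 CL' θ'' A₁' A₃' B₃ Bd Bq κW' c := by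
  unfold constH313
  have hθ''0 : 0 ≤ θ'' := hθ.trans hθ''
  have hA₃'0 : 0 ≤ A₃' := h₃.trans h₃'
  have e2 : κW * Bd * B₃ * c ≤ κW' * Bd * B₃ * c := by gcongr
  have e3 : θ' * (A₃ * B₃ * c) * c ≤ θ'' * (A₃' * B₃ * c) * c := by gcongr
  have e4 : Bq * (B₃ * (B₃ * A₁ * c) * c) * c ≤ Bq * (B₃ * (B₃ * A₁' * c) * c) * c := by gcongr
  have e5 : θ' * (A₃ * (B₃ * (B₃ * A₁ * c) * c) * c) * c ≤ θ'' * (A₃' * (B₃ * (B₃ * A₁' * c) * c) * c) * c := by gcongr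
  linarith

omit [Fintype PX] in
/-- ★ **THEOREM 3.13, THE LEFT (3.43) MEMBER OF 𝔊 — Φ^Y_β∘∇_U∘𝔊 through (3.153)**, the probe twin of `B9Thm313WholeLeft.GG_entry1_of_letters`: from Theorem
3.3's (3.42)₁ (`he0`) and the probe of (3.43)₁ (`h43`) for G₀, the step K′₁ = G₀(Δ′_π + Δ⁽²⁾_π) on 𝔠⁽²⁾ (`hK`, θc < 1) and its Hölder probe (`hpY`, θ_He^{−δ_Kd}),
the resolvent identity, the letters of `Letters313` (`gD2 gQs2 rgd2 c1_2 q2`), `Letters313D.rgdH` (into the scalar Hölder class `bW`), the probe letters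
`hpQ` (Φ∇G₀Q*, `LettersHH.pQ`) and `hpD` (Φ∇G₀D out of `bW`, `Letters313H.pYDH`), and (3.153): Φ^Y_β∘∇_U∘𝔊 has majorant `constH313 …`·e^{−ρ′d} from 𝔠^{(0)}
into the probe class 𝔠_P^{(β−1)} (ρ′ + 3σ ≦ ρ ≦ min(δ₀, δ₃), ρ + σ ≦ δ_K), whence the two-space shape C·(Lʲη)^{1−β}e^{−ρ′d}.
[cite: Balaban1985BackgroundPropagators, Thm 3.13 p.426 + (3.152)–(3.153) p.426 + (3.138) p.423 + (3.43) p.398] -/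
theorem GG_probe43L_of_letters (hG : GeoOK g) {𝔬 : Ops g B X Y Z W} (𝔭 : HolderProbes g B X Y PX PY) {U : B.Cfg}
    {bW : BlockNorm (toB6 g R₀ H₀) (W → ℝ)} {θ θH B₀ B₃ Bh Bq Bd β δ₀ δ₃ δK ρ ρ' σ c : ℝ} (hrow : RowSum (toB6 g R₀ H₀) σ c) (hc : 0 ≤ c)
    (hθ : 0 ≤ θ) (hθH : 0 ≤ θH) (hB₀ : 0 ≤ B₀) (hB₃ : 0 ≤ B₃) (hBh : 0 ≤ Bh) (hBq : 0 ≤ Bq) (hBd : 0 ≤ Bd) (hσ : 0 ≤ σ) (hρ' : 0 ≤ ρ')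
    (hρ'ρ : ρ' + 3 * σ ≤ ρ) (hρS : ρ ≤ δ₀) (hρ₃ : ρ ≤ δ₃) (hρδ : ρ + σ ≤ δK) (hq : θ * c < 1)
    (hK : HasMaj (cNorm R₀ H₀ 𝔬.blk hG.lenle 2) (cNorm R₀ H₀ 𝔬.blk hG.lenle 2) (𝔬.G0 U ∘ₗ (𝔬.Tpi U + 𝔬.T2 U))
      (fun a b => θ * Real.exp (-(δK * g.dist a b))))
    (he0 : HasMajorant (g := toB6 g R₀ H₀) 𝔬.blk (𝔬.G0 U) (fun a b => B₀ * g.len a ^ 2 * Real.exp (-(δ₀ * g.dist a b))))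
    (h43 : HasMajorantHom (g := toB6 g R₀ H₀) 𝔬.blk 𝔭.blkPY (𝔭.ΦY U β ∘ₗ (𝔬.D U ∘ₗ 𝔬.G0 U))
      (fun (a b : g.Site) => Bh * g.len a ^ (1 - β) * Real.exp (-(δ₀ * g.dist a b))))
    (hpY : HasMaj (cNormR R₀ H₀ 𝔬.blk hG.lenle (-2)) (cNormR R₀ H₀ 𝔭.blkPY hG.lenle (β - 1))
      ((𝔭.ΦY U β ∘ₗ 𝔬.D U ∘ₗ 𝔬.G0 U) ∘ₗ (𝔬.Tpi U + 𝔬.T2 U)) (fun a b => θH * Real.exp (-(δK * g.dist a b))))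
    (hpQ : HasMaj (cNormR R₀ H₀ 𝔬.blkZ hG.lenle 0) (cNormR R₀ H₀ 𝔭.blkPY hG.lenle (β - 1))
      ((𝔭.ΦY U β ∘ₗ 𝔬.D U ∘ₗ 𝔬.G0 U) ∘ₗ 𝔬.Qstar U) (fun a b => Bq * Real.exp (-(δ₃ * g.dist a b))))
    (hpD : HasMaj bW (cNormR R₀ H₀ 𝔭.blkPY hG.lenle (β - 1)) ((𝔭.ΦY U β ∘ₗ 𝔬.D U ∘ₗ 𝔬.G0 U) ∘ₗ 𝔬.Dv U)
      (fun a b => Bd * Real.exp (-(δ₃ * g.dist a b))))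
    (hL : Letters313 𝔬 R₀ H₀ hG B₃ δ₃ U) (hrgdH : HasMaj (cNorm R₀ H₀ 𝔬.blk hG.lenle 0) bW
      (𝔬.R U ∘ₗ 𝔬.Dvstar U ∘ₗ 𝔬.G1 U ∘ₗ LinearMap.id) (fun a b => B₃ * Real.exp (-(δ₃ * g.dist a b))))
    (hI : Identities 𝔬 U) :
    HasMajorantHom (g := toB6 g R₀ H₀) 𝔬.blk 𝔭.blkPY (𝔭.ΦY U β ∘ₗ (𝔬.D U ∘ₗ 𝔬.GG U))
      (fun (a b : g.Site) => constH313 (Bh + θH * (B₀ * (1 - θ * c)⁻¹) * c) θH (B₀ * (1 - θ * c)⁻¹) (B₃ * (1 - θ * c)⁻¹) B₃ Bd Bq bW.κ c *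
        g.len a ^ (1 - β) * Real.exp (-(ρ' * g.dist a b))) := by
  have hq1 : 0 ≤ (1 - θ * c)⁻¹ := inv_nonneg.mpr (by linarith)
  have hA₁ : 0 ≤ B₀ * (1 - θ * c)⁻¹ := mul_nonneg hB₀ hq1
  have hA₃ : 0 ≤ B₃ * (1 - θ * c)⁻¹ := mul_nonneg hB₃ hq1
  have hCL : 0 ≤ Bh + θH * (B₀ * (1 - θ * c)⁻¹) * c := add_nonneg hBh (mul_nonneg (mul_nonneg hθH hA₁) hc)
  have hfix1 := fix_of_inverses hI.invG0' hI.invG1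
  have hρ0 : 0 ≤ ρ := by linarith
  have htri : Triangle254 (toB6 g R₀ H₀) := fun a b c => hG.tri a b c
  set E : (X → ℝ) →ₗ[ℝ] (PY → ℝ) := 𝔭.ΦY U β ∘ₗ 𝔬.D U with hE
  set bout := cNormR R₀ H₀ 𝔭.blkPY hG.lenle (β - 1) with hbout
  -- (a) the right entries of G₁ in the real classes: G₁ : 𝔠^{(0)} → 𝔠^{(−2)}, G₁D : W^{(−1)} → 𝔠^{(−2)}, G₁Q* : Z^{(0)} → 𝔠^{(−2)}
  have hG1 : HasMaj (cNormR R₀ H₀ 𝔬.blk hG.lenle 0) (cNormR R₀ H₀ 𝔬.blk hG.lenle (-2)) (𝔬.G1 U ∘ₗ LinearMap.id)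
      (fun a b => B₀ * (1 - θ * c)⁻¹ * Real.exp (-(ρ * g.dist a b))) := by
    rw [LinearMap.comp_id]
    have h := hasMaj_toR hG (hasMaj_entry0_cNorm hG hrow hθ hB₀ hρ0 hρS hρδ hK he0 hfix1 hq)
    simp only [Nat.cast_zero, neg_zero, Nat.cast_ofNat] at h
    exact h
  have hGD : HasMaj (cNormR R₀ H₀ 𝔬.blkW hG.lenle (-1)) (cNormR R₀ H₀ 𝔬.blk hG.lenle (-2)) (𝔬.G1 U ∘ₗ 𝔬.Dv U)
      (fun a b => B₃ * (1 - θ * c)⁻¹ * Real.exp (-(ρ * g.dist a b))) := by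
    have h := hasMaj_toR hG (hasMaj_right_of_step hG hrow hθ hB₃ hρ0 hρ₃ hρδ hK hL.gD2 hfix1 hq)
    simp only [Nat.cast_one, Nat.cast_ofNat] at h
    exact h
  have hGQ : HasMaj (cNormR R₀ H₀ 𝔬.blkZ hG.lenle 0) (cNormR R₀ H₀ 𝔬.blk hG.lenle (-2)) (𝔬.G1 U ∘ₗ 𝔬.Qstar U)
      (fun a b => B₃ * (1 - θ * c)⁻¹ * Real.exp (-(ρ * g.dist a b))) := by
    have h := hasMaj_toR hG (hasMaj_right_of_step hG hrow hθ hB₃ hρ0 hρ₃ hρδ hK hL.gQs2 hfix1 hq)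
    simp only [Nat.cast_zero, neg_zero, Nat.cast_ofNat] at h
    exact h
  -- (b) the head E G₀ : 𝔠^{(0)} → 𝔠_P^{(β−1)} from (3.43)₁ for G₀, and E G₁ : 𝔠^{(0)} → 𝔠_P^{(β−1)}
  have hE0 : HasMaj (cNormR R₀ H₀ 𝔬.blk hG.lenle 0) bout (E ∘ₗ 𝔬.G0 U ∘ₗ LinearMap.id) (fun a b => Bh * Real.exp (-(δ₀ * g.dist a b))) := by
    rw [LinearMap.comp_id]
    have h43' : HasMajorantHom (g := toB6 g R₀ H₀) 𝔬.blk 𝔭.blkPY (E ∘ₗ 𝔬.G0 U)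
        (fun (a b : g.Site) => Bh * g.len a ^ (1 - β) * Real.exp (-(δ₀ * g.dist a b))) := h43
    have h := hasMaj_cNormR_of_hasMajorantHom hG (C := fun a b => Bh * Real.exp (-(δ₀ * g.dist a b)))
      (fun a b => mul_nonneg hBh (Real.exp_nonneg _)) (1 - β) 0
      (hasMajorantHom_mono (g := toB6 g R₀ H₀) 𝔬.blk 𝔭.blkPY h43' fun a b => le_of_eq (by simp only [Real.rpow_zero, mul_one]; ring))
    have e : -(1 - β) = β - 1 := by ring
    rw [e] at h
    exact h
  have hKE : HasMaj (cNormR R₀ H₀ 𝔬.blk hG.lenle (-2)) bout (E ∘ₗ 𝔬.G0 U ∘ₗ (𝔬.Tpi U + 𝔬.T2 U))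
      (fun a b => θH * Real.exp (-(δK * g.dist a b))) := hpY
  have hD1 : HasMaj (cNormR R₀ H₀ 𝔬.blk hG.lenle 0) bout (E ∘ₗ 𝔬.G1 U ∘ₗ LinearMap.id)
      (fun y y' => (Bh + θH * (B₀ * (1 - θ * c)⁻¹) * c) * Real.exp (-(ρ * g.dist y y'))) :=
    hasMaj_left_rightR hG hrow hθH hBh hA₁ hρ0 hρS le_rfl hρδ hKE hE0 hG1 hfix1
  -- (c) TERM B = (E G₁D)(RD*G₁) = (E G₀D)(RD*G₁) + ((E G₀T₁)(G₁D))(RD*G₁): the first summand through `bW`, the second through W^{(−1)}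
  have hρ'₃ : ρ' ≤ δ₃ := by linarith
  have hρ'σ₃ : ρ' + σ ≤ δ₃ := by linarith
  have hrgdH' : HasMaj (cNormR R₀ H₀ 𝔬.blk hG.lenle 0) bW (𝔬.R U ∘ₗ 𝔬.Dvstar U ∘ₗ 𝔬.G1 U ∘ₗ LinearMap.id)
      (fun a b => B₃ * Real.exp (-(δ₃ * g.dist a b))) := by
    have h := hasMaj_toR_src hG hrgdH
    simp only [Nat.cast_zero, neg_zero] at h
    exact h
  have hB1 : HasMaj (cNormR R₀ H₀ 𝔬.blk hG.lenle 0) bout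
      ((E ∘ₗ 𝔬.G0 U ∘ₗ 𝔬.Dv U) ∘ₗ (𝔬.R U ∘ₗ 𝔬.Dvstar U ∘ₗ 𝔬.G1 U ∘ₗ LinearMap.id))
      (fun y y' => bW.κ * Bd * B₃ * c * Real.exp (-(ρ' * g.dist y y'))) :=
    hasMaj_comp_exp htri hG.dnn hrow hBd hB₃ hρ' hρ'₃ hρ'σ₃ hpD hrgdH'
  have hrgd2' : HasMaj (cNormR R₀ H₀ 𝔬.blk hG.lenle 0) (cNormR R₀ H₀ 𝔬.blkW hG.lenle (-1))
      (𝔬.R U ∘ₗ 𝔬.Dvstar U ∘ₗ 𝔬.G1 U ∘ₗ LinearMap.id) (fun a b => B₃ * Real.exp (-(δ₃ * g.dist a b))) := by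
    have h := hasMaj_toR hG hL.rgd2
    simp only [Nat.cast_zero, neg_zero, Nat.cast_one] at h
    exact h
  have hGDT : HasMaj (cNormR R₀ H₀ 𝔬.blkW hG.lenle (-1)) bout
      ((E ∘ₗ 𝔬.G0 U ∘ₗ (𝔬.Tpi U + 𝔬.T2 U)) ∘ₗ (𝔬.G1 U ∘ₗ 𝔬.Dv U))
      (fun y y' => (cNormR R₀ H₀ 𝔬.blk hG.lenle (-2) (X := X)).κ * θH * (B₃ * (1 - θ * c)⁻¹) * c *
        Real.exp (-((ρ' + σ) * g.dist y y'))) :=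
    hasMaj_comp_exp htri hG.dnn hrow hθH hA₃ (by linarith) (by linarith) (by linarith) hKE hGD
  simp only [cNormR_κ, one_mul] at hGDT
  have hθA₃ : 0 ≤ θH * (B₃ * (1 - θ * c)⁻¹) * c := mul_nonneg (mul_nonneg hθH hA₃) hc
  have hB2 : HasMaj (cNormR R₀ H₀ 𝔬.blk hG.lenle 0) bout
      (((E ∘ₗ 𝔬.G0 U ∘ₗ (𝔬.Tpi U + 𝔬.T2 U)) ∘ₗ (𝔬.G1 U ∘ₗ 𝔬.Dv U)) ∘ₗ (𝔬.R U ∘ₗ 𝔬.Dvstar U ∘ₗ 𝔬.G1 U ∘ₗ LinearMap.id))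
      (fun y y' => (cNormR R₀ H₀ 𝔬.blkW hG.lenle (-1) (X := W)).κ * (θH * (B₃ * (1 - θ * c)⁻¹) * c) * B₃ * c *
        Real.exp (-(ρ' * g.dist y y'))) :=
    hasMaj_comp_exp htri hG.dnn hrow hθA₃ hB₃ hρ' hρ'₃ le_rfl hGDT hrgd2'
  simp only [cNormR_κ, one_mul] at hB2
  have eB : (E ∘ₗ 𝔬.G1 U ∘ₗ 𝔬.Dv U) ∘ₗ (𝔬.R U ∘ₗ 𝔬.Dvstar U ∘ₗ 𝔬.G1 U ∘ₗ LinearMap.id) =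
      (E ∘ₗ 𝔬.G0 U ∘ₗ 𝔬.Dv U) ∘ₗ (𝔬.R U ∘ₗ 𝔬.Dvstar U ∘ₗ 𝔬.G1 U ∘ₗ LinearMap.id) +
        (((E ∘ₗ 𝔬.G0 U ∘ₗ (𝔬.Tpi U + 𝔬.T2 U)) ∘ₗ (𝔬.G1 U ∘ₗ 𝔬.Dv U)) ∘ₗ
          (𝔬.R U ∘ₗ 𝔬.Dvstar U ∘ₗ 𝔬.G1 U ∘ₗ LinearMap.id)) := by
    rw [comp_fix_left_right E (𝔬.Dv U) hfix1, LinearMap.add_comp]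
  have hB := hB1.add hB2
  rw [← eB] at hB
  -- (d) TERM C = (E G₁Q*)((QG₁Q*)⁻¹QG₁) through the sup classes Z², Z⁰ and the probe head `hpQ`
  have hQG : HasMaj (cNormR R₀ H₀ 𝔬.blk hG.lenle 0) (cNormR R₀ H₀ 𝔬.blkZ hG.lenle (-2)) (𝔬.Q U ∘ₗ (𝔬.G1 U ∘ₗ LinearMap.id))
      (fun a b => (cNormR R₀ H₀ 𝔬.blk hG.lenle (-2) (X := X)).κ * B₃ * (B₀ * (1 - θ * c)⁻¹) * c *
        Real.exp (-((ρ' + 2 * σ) * g.dist a b))) := by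
    have hq2' : HasMaj (cNormR R₀ H₀ 𝔬.blk hG.lenle (-2)) (cNormR R₀ H₀ 𝔬.blkZ hG.lenle (-2)) (𝔬.Q U)
        (fun a b => B₃ * Real.exp (-(δ₃ * g.dist a b))) := by
      have h := hasMaj_toR hG hL.q2
      simp only [Nat.cast_ofNat] at h
      exact h
    exact hasMaj_comp_exp htri hG.dnn hrow hB₃ hA₁ (by linarith) (by linarith) (by linarith) hq2' hG1
  simp only [cNormR_κ, one_mul] at hQG
  have hK₁ : 0 ≤ B₃ * (B₀ * (1 - θ * c)⁻¹) * c := mul_nonneg (mul_nonneg hB₃ hA₁) hc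
  have hc12' : HasMaj (cNormR R₀ H₀ 𝔬.blkZ hG.lenle (-2)) (cNormR R₀ H₀ 𝔬.blkZ hG.lenle 0) (𝔬.C1 U)
      (fun a b => B₃ * Real.exp (-(δ₃ * g.dist a b))) := by
    have h := hasMaj_toR hG hL.c1_2
    simp only [Nat.cast_zero, neg_zero, Nat.cast_ofNat] at h
    exact h
  have hCQG : HasMaj (cNormR R₀ H₀ 𝔬.blk hG.lenle 0) (cNormR R₀ H₀ 𝔬.blkZ hG.lenle 0)
      (𝔬.C1 U ∘ₗ (𝔬.Q U ∘ₗ (𝔬.G1 U ∘ₗ LinearMap.id)))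
      (fun a b => (cNormR R₀ H₀ 𝔬.blkZ hG.lenle (-2) (X := Z)).κ * B₃ * (B₃ * (B₀ * (1 - θ * c)⁻¹) * c) * c *
        Real.exp (-((ρ' + σ) * g.dist a b))) :=
    hasMaj_comp_exp htri hG.dnn hrow hB₃ hK₁ (by linarith) (by linarith) (by linarith) hc12' hQG
  simp only [cNormR_κ, one_mul] at hCQG
  have hD1Q : HasMaj (cNormR R₀ H₀ 𝔬.blkZ hG.lenle 0) bout (E ∘ₗ 𝔬.G1 U ∘ₗ 𝔬.Qstar U)
      (fun y y' => (Bq + θH * (B₃ * (1 - θ * c)⁻¹) * c) * Real.exp (-((ρ' + σ) * g.dist y y'))) :=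
    hasMaj_left_rightR hG hrow hθH hBq hA₃ (by linarith) (by linarith) (by linarith) (by linarith) hKE hpQ hGQ hfix1
  have hBq' : 0 ≤ Bq + θH * (B₃ * (1 - θ * c)⁻¹) * c := add_nonneg hBq hθA₃
  have hK₂ : 0 ≤ B₃ * (B₃ * (B₀ * (1 - θ * c)⁻¹) * c) * c := mul_nonneg (mul_nonneg hB₃ hK₁) hc
  have hC : HasMaj (cNormR R₀ H₀ 𝔬.blk hG.lenle 0) bout
      ((E ∘ₗ 𝔬.G1 U ∘ₗ 𝔬.Qstar U) ∘ₗ (𝔬.C1 U ∘ₗ (𝔬.Q U ∘ₗ (𝔬.G1 U ∘ₗ LinearMap.id))))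
      (fun y y' => (cNormR R₀ H₀ 𝔬.blkZ hG.lenle 0 (X := Z)).κ * (Bq + θH * (B₃ * (1 - θ * c)⁻¹) * c) *
        (B₃ * (B₃ * (B₀ * (1 - θ * c)⁻¹) * c) * c) * c * Real.exp (-(ρ' * g.dist y y'))) :=
    hasMaj_comp_exp htri hG.dnn hrow hBq' hK₂ hρ' (by linarith) le_rfl hD1Q hCQG
  simp only [cNormR_κ, one_mul] at hC
  -- (e) assembling (3.153) with the left factor E
  have h := ((hD1.of_rate_le hG.dnn hCL (by linarith : ρ' ≤ ρ)).sub hB).sub hC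
  rw [← E_GG_eq hI E] at h
  have hC0 : 0 ≤ constH313 (Bh + θH * (B₀ * (1 - θ * c)⁻¹) * c) θH (B₀ * (1 - θ * c)⁻¹) (B₃ * (1 - θ * c)⁻¹) B₃ Bd Bq bW.κ c :=
    constH313_nonneg hCL hθH hA₁ hA₃ hB₃ hBd hBq bW.κ_nonneg hc
  have h2 : HasMaj (cNormR R₀ H₀ 𝔬.blk hG.lenle 0) bout (E ∘ₗ 𝔬.GG U)
      (fun a b => constH313 (Bh + θH * (B₀ * (1 - θ * c)⁻¹) * c) θH (B₀ * (1 - θ * c)⁻¹) (B₃ * (1 - θ * c)⁻¹) B₃ Bd Bq bW.κ c *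
        Real.exp (-(ρ' * g.dist a b))) :=
    h.mono fun a b => le_of_eq (by simp only [constH313, toB6_dist]; ring)
  have h' := hasMajorantHom_of_hasMaj_cNormR hG (fun a b => mul_nonneg hC0 (Real.exp_nonneg _)) h2
  have h'' : HasMajorantHom (g := toB6 g R₀ H₀) 𝔬.blk 𝔭.blkPY (𝔭.ΦY U β ∘ₗ (𝔬.D U ∘ₗ 𝔬.GG U))
      (fun (a b : g.Site) => constH313 (Bh + θH * (B₀ * (1 - θ * c)⁻¹) * c) θH (B₀ * (1 - θ * c)⁻¹) (B₃ * (1 - θ * c)⁻¹) B₃ Bd Bq bW.κ c *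
        Real.exp (-(ρ' * g.dist a b)) * g.len a ^ (-(β - 1)) * g.len b ^ (0 : ℝ)) := h'
  refine hasMajorantHom_mono (g := toB6 g R₀ H₀) 𝔬.blk 𝔭.blkPY h'' fun a b => le_of_eq ?_
  simp only [Real.rpow_zero, mul_one, show -(β - 1) = 1 - β by ring]
  ring

omit [Fintype PY] in
/-- ★ **THEOREM 3.13, THE RIGHT (3.43) MEMBER OF 𝔊 — Φ^X_β∘𝔊∘∇\*_U through (3.153)**, the probe twin of `B9Thm313Whole.GG_entry2_of_letters`: from Theorem 3.3's
(3.42)₃ (`he2`) and the probe of (3.43)₂ (`h43`) for G₀, the step K′₁ on 𝔠⁽¹⁾ (`hK`, θc < 1) and its probe (`hpX`, θ_He^{−δ_Kd}), the letters of `Letters313`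
(`gD1 gQs1 rgd1 c1_1 q1`), the probe letters `hpDv` (ΦG₀D from the scalar sup class) and `hpQs` (ΦG₀Q* from Z^{len}) of `Letters313H`, and (3.153):
Φ^X_β∘𝔊∘∇\*_U has majorant `constH313 …`·e^{−ρ′d} from 𝔠_Y^{(0)} into 𝔠_P^{(β−1)}, whence the two-space shape C·(Lʲη)^{1−β}e^{−ρ′d}.
[cite: Balaban1985BackgroundPropagators, Thm 3.13 p.426 + (3.152)–(3.153) p.426 + (3.138) p.423 + (3.43) p.398] -/
theorem GG_probe43R_of_letters (hG : GeoOK g) {𝔬 : Ops g B X Y Z W} (𝔭 : HolderProbes g B X Y PX PY) {U : B.Cfg}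
    {θ θH B₀ B₃ Bh Bx β δ₀ δ₃ δK ρ ρ' σ c : ℝ} (hrow : RowSum (toB6 g R₀ H₀) σ c) (hc : 0 ≤ c)
    (hθ : 0 ≤ θ) (hθH : 0 ≤ θH) (hB₀ : 0 ≤ B₀) (hB₃ : 0 ≤ B₃) (hBh : 0 ≤ Bh) (hBx : 0 ≤ Bx) (hσ : 0 ≤ σ) (hρ' : 0 ≤ ρ')
    (hρ'ρ : ρ' + 3 * σ ≤ ρ) (hρS : ρ ≤ δ₀) (hρ₃ : ρ ≤ δ₃) (hρδ : ρ + σ ≤ δK) (hq : θ * c < 1)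
    (hK : HasMaj (cNorm R₀ H₀ 𝔬.blk hG.lenle 1) (cNorm R₀ H₀ 𝔬.blk hG.lenle 1) (𝔬.G0 U ∘ₗ (𝔬.Tpi U + 𝔬.T2 U))
      (fun a b => θ * Real.exp (-(δK * g.dist a b))))
    (he2 : HasMajorantHom (g := toB6 g R₀ H₀) 𝔬.blkY 𝔬.blk (𝔬.G0 U ∘ₗ 𝔬.Dstar U)
      (fun a b => B₀ * g.len a * Real.exp (-(δ₀ * g.dist a b))))
    (h43 : HasMajorantHom (g := toB6 g R₀ H₀) 𝔬.blkY 𝔭.blkPX (𝔭.ΦX U β ∘ₗ (𝔬.G0 U ∘ₗ 𝔬.Dstar U))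
      (fun (a b : g.Site) => Bh * g.len a ^ (1 - β) * Real.exp (-(δ₀ * g.dist a b))))
    (hpX : HasMaj (cNormR R₀ H₀ 𝔬.blk hG.lenle (-1)) (cNormR R₀ H₀ 𝔭.blkPX hG.lenle (β - 1))
      ((𝔭.ΦX U β ∘ₗ 𝔬.G0 U) ∘ₗ (𝔬.Tpi U + 𝔬.T2 U)) (fun a b => θH * Real.exp (-(δK * g.dist a b))))
    (hpDv : HasMaj (cNormR R₀ H₀ 𝔬.blkW hG.lenle 0) (cNormR R₀ H₀ 𝔭.blkPX hG.lenle (β - 1)) ((𝔭.ΦX U β ∘ₗ 𝔬.G0 U) ∘ₗ 𝔬.Dv U)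
      (fun a b => Bx * Real.exp (-(δ₃ * g.dist a b))))
    (hpQs : HasMaj (cNormR R₀ H₀ 𝔬.blkZ hG.lenle 1) (cNormR R₀ H₀ 𝔭.blkPX hG.lenle (β - 1)) ((𝔭.ΦX U β ∘ₗ 𝔬.G0 U) ∘ₗ 𝔬.Qstar U)
      (fun a b => Bx * Real.exp (-(δ₃ * g.dist a b))))
    (hL : Letters313 𝔬 R₀ H₀ hG B₃ δ₃ U) (hI : Identities 𝔬 U) :
    HasMajorantHom (g := toB6 g R₀ H₀) 𝔬.blkY 𝔭.blkPX (𝔭.ΦX U β ∘ₗ (𝔬.GG U ∘ₗ 𝔬.Dstar U))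
      (fun (a b : g.Site) => constH313 (Bh + θH * (B₀ * (1 - θ * c)⁻¹) * c) θH (B₀ * (1 - θ * c)⁻¹) (B₃ * (1 - θ * c)⁻¹) B₃ Bx Bx 1 c *
        g.len a ^ (1 - β) * Real.exp (-(ρ' * g.dist a b))) := by
  have hq1 : 0 ≤ (1 - θ * c)⁻¹ := inv_nonneg.mpr (by linarith)
  have hA₁ : 0 ≤ B₀ * (1 - θ * c)⁻¹ := mul_nonneg hB₀ hq1
  have hA₃ : 0 ≤ B₃ * (1 - θ * c)⁻¹ := mul_nonneg hB₃ hq1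
  have hCL : 0 ≤ Bh + θH * (B₀ * (1 - θ * c)⁻¹) * c := add_nonneg hBh (mul_nonneg (mul_nonneg hθH hA₁) hc)
  have hfix1 := fix_of_inverses hI.invG0' hI.invG1
  have hρ0 : 0 ≤ ρ := by linarith
  have htri : Triangle254 (toB6 g R₀ H₀) := fun a b c => hG.tri a b c
  set E : (X → ℝ) →ₗ[ℝ] (PX → ℝ) := 𝔭.ΦX U β with hE
  set bout := cNormR R₀ H₀ 𝔭.blkPX hG.lenle (β - 1) with hbout
  -- (a) the right entries of G₁ in the real classes: G₁∇* : Y^{(0)} → 𝔠^{(−1)}, G₁D : W^{(0)} → 𝔠^{(−1)}, G₁Q* : Z^{(1)} → 𝔠^{(−1)}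
  have hG1 : HasMaj (cNormR R₀ H₀ 𝔬.blkY hG.lenle 0) (cNormR R₀ H₀ 𝔬.blk hG.lenle (-1)) (𝔬.G1 U ∘ₗ 𝔬.Dstar U)
      (fun a b => B₀ * (1 - θ * c)⁻¹ * Real.exp (-(ρ * g.dist a b))) := by
    have h := hasMaj_toR hG (hasMaj_entry2_cNorm hG hrow hθ hB₀ hρ0 hρS hρδ hK he2 hfix1 hq)
    simp only [Nat.cast_zero, neg_zero, Nat.cast_one] at h
    exact h
  have hGD : HasMaj (cNormR R₀ H₀ 𝔬.blkW hG.lenle 0) (cNormR R₀ H₀ 𝔬.blk hG.lenle (-1)) (𝔬.G1 U ∘ₗ 𝔬.Dv U)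
      (fun a b => B₃ * (1 - θ * c)⁻¹ * Real.exp (-(ρ * g.dist a b))) := by
    have h := hasMaj_toR hG (hasMaj_right_of_step hG hrow hθ hB₃ hρ0 hρ₃ hρδ hK hL.gD1 hfix1 hq)
    simp only [Nat.cast_zero, neg_zero, Nat.cast_one] at h
    exact h
  have hGQ : HasMaj (cNormR R₀ H₀ 𝔬.blkZ hG.lenle 1) (cNormR R₀ H₀ 𝔬.blk hG.lenle (-1)) (𝔬.G1 U ∘ₗ 𝔬.Qstar U)
      (fun a b => B₃ * (1 - θ * c)⁻¹ * Real.exp (-(ρ * g.dist a b))) := by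
    have h := hasMaj_toR_tgt hG (hasMaj_len_src hG (hasMaj_right_of_step_weight hG hG.lenpos hrow hθ hB₃ hρ0 hρ₃ hρδ hK hL.gQs1 hfix1 hq))
    simp only [Nat.cast_one] at h
    exact h
  -- (b) the head E G₀∇* : Y^{(0)} → 𝔠_P^{(β−1)} from (3.43)₂ for G₀, and E G₁∇*
  have hE0 : HasMaj (cNormR R₀ H₀ 𝔬.blkY hG.lenle 0) bout (E ∘ₗ 𝔬.G0 U ∘ₗ 𝔬.Dstar U) (fun a b => Bh * Real.exp (-(δ₀ * g.dist a b))) := by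
    have h := hasMaj_cNormR_of_hasMajorantHom hG (C := fun a b => Bh * Real.exp (-(δ₀ * g.dist a b)))
      (fun a b => mul_nonneg hBh (Real.exp_nonneg _)) (1 - β) 0
      (hasMajorantHom_mono (g := toB6 g R₀ H₀) 𝔬.blkY 𝔭.blkPX h43 fun a b => le_of_eq (by simp only [Real.rpow_zero, mul_one]; ring))
    have e : -(1 - β) = β - 1 := by ring
    rw [e] at h
    exact h
  have hKE : HasMaj (cNormR R₀ H₀ 𝔬.blk hG.lenle (-1)) bout (E ∘ₗ 𝔬.G0 U ∘ₗ (𝔬.Tpi U + 𝔬.T2 U))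
      (fun a b => θH * Real.exp (-(δK * g.dist a b))) := hpX
  have hD1 : HasMaj (cNormR R₀ H₀ 𝔬.blkY hG.lenle 0) bout (E ∘ₗ 𝔬.G1 U ∘ₗ 𝔬.Dstar U)
      (fun y y' => (Bh + θH * (B₀ * (1 - θ * c)⁻¹) * c) * Real.exp (-(ρ * g.dist y y'))) :=
    hasMaj_left_rightR hG hrow hθH hBh hA₁ hρ0 hρS le_rfl hρδ hKE hE0 hG1 hfix1
  -- (c) TERM B = (E G₁D)(RD*G₁∇*): E G₁D : W^{(0)} → 𝔠_P^{(β−1)} by the left-and-right entry, then the letter `rgd1`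
  have hρ'₃ : ρ' ≤ δ₃ := by linarith
  have hθA₃ : 0 ≤ θH * (B₃ * (1 - θ * c)⁻¹) * c := mul_nonneg (mul_nonneg hθH hA₃) hc
  have hED : HasMaj (cNormR R₀ H₀ 𝔬.blkW hG.lenle 0) bout (E ∘ₗ 𝔬.G1 U ∘ₗ 𝔬.Dv U)
      (fun y y' => (Bx + θH * (B₃ * (1 - θ * c)⁻¹) * c) * Real.exp (-((ρ' + σ) * g.dist y y'))) :=
    hasMaj_left_rightR hG hrow hθH hBx hA₃ (by linarith) (by linarith) (by linarith) (by linarith) hKE hpDv hGD hfix1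
  have hrgd1' : HasMaj (cNormR R₀ H₀ 𝔬.blkY hG.lenle 0) (cNormR R₀ H₀ 𝔬.blkW hG.lenle 0)
      (𝔬.R U ∘ₗ 𝔬.Dvstar U ∘ₗ 𝔬.G1 U ∘ₗ 𝔬.Dstar U) (fun a b => B₃ * Real.exp (-(δ₃ * g.dist a b))) := by
    have h := hasMaj_toR hG hL.rgd1
    simp only [Nat.cast_zero, neg_zero] at h
    exact h
  have hBx' : 0 ≤ Bx + θH * (B₃ * (1 - θ * c)⁻¹) * c := add_nonneg hBx hθA₃
  have hB : HasMaj (cNormR R₀ H₀ 𝔬.blkY hG.lenle 0) bout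
      ((E ∘ₗ 𝔬.G1 U ∘ₗ 𝔬.Dv U) ∘ₗ (𝔬.R U ∘ₗ 𝔬.Dvstar U ∘ₗ 𝔬.G1 U ∘ₗ 𝔬.Dstar U))
      (fun y y' => (cNormR R₀ H₀ 𝔬.blkW hG.lenle 0 (X := W)).κ * (Bx + θH * (B₃ * (1 - θ * c)⁻¹) * c) * B₃ * c *
        Real.exp (-(ρ' * g.dist y y'))) :=
    hasMaj_comp_exp htri hG.dnn hrow hBx' hB₃ hρ' hρ'₃ le_rfl hED hrgd1'
  simp only [cNormR_κ, one_mul] at hB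
  -- (d) TERM C = (E G₁Q*)((QG₁Q*)⁻¹QG₁∇*) through Y⁰ → Z¹ → Z^{len} = Z^{(1)}
  have hq1' : HasMaj (cNormR R₀ H₀ 𝔬.blk hG.lenle (-1)) (cNormR R₀ H₀ 𝔬.blkZ hG.lenle (-1)) (𝔬.Q U)
      (fun a b => B₃ * Real.exp (-(δ₃ * g.dist a b))) := by
    have h := hasMaj_toR hG hL.q1
    simp only [Nat.cast_one] at h
    exact h
  have hQG : HasMaj (cNormR R₀ H₀ 𝔬.blkY hG.lenle 0) (cNormR R₀ H₀ 𝔬.blkZ hG.lenle (-1)) (𝔬.Q U ∘ₗ (𝔬.G1 U ∘ₗ 𝔬.Dstar U))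
      (fun a b => (cNormR R₀ H₀ 𝔬.blk hG.lenle (-1) (X := X)).κ * B₃ * (B₀ * (1 - θ * c)⁻¹) * c *
        Real.exp (-((ρ' + 2 * σ) * g.dist a b))) :=
    hasMaj_comp_exp htri hG.dnn hrow hB₃ hA₁ (by linarith) (by linarith) (by linarith) hq1' hG1
  simp only [cNormR_κ, one_mul] at hQG
  have hK₁ : 0 ≤ B₃ * (B₀ * (1 - θ * c)⁻¹) * c := mul_nonneg (mul_nonneg hB₃ hA₁) hc
  have hc11' : HasMaj (cNormR R₀ H₀ 𝔬.blkZ hG.lenle (-1)) (cNormR R₀ H₀ 𝔬.blkZ hG.lenle 1) (𝔬.C1 U)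
      (fun a b => B₃ * Real.exp (-(δ₃ * g.dist a b))) := by
    have h := hasMaj_toR_src hG (hasMaj_len_tgt hG hL.c1_1)
    simp only [Nat.cast_one] at h
    exact h
  have hCQG : HasMaj (cNormR R₀ H₀ 𝔬.blkY hG.lenle 0) (cNormR R₀ H₀ 𝔬.blkZ hG.lenle 1)
      (𝔬.C1 U ∘ₗ (𝔬.Q U ∘ₗ (𝔬.G1 U ∘ₗ 𝔬.Dstar U)))
      (fun a b => (cNormR R₀ H₀ 𝔬.blkZ hG.lenle (-1) (X := Z)).κ * B₃ * (B₃ * (B₀ * (1 - θ * c)⁻¹) * c) * c *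
        Real.exp (-((ρ' + σ) * g.dist a b))) :=
    hasMaj_comp_exp htri hG.dnn hrow hB₃ hK₁ (by linarith) (by linarith) (by linarith) hc11' hQG
  simp only [cNormR_κ, one_mul] at hCQG
  have hD1Q : HasMaj (cNormR R₀ H₀ 𝔬.blkZ hG.lenle 1) bout (E ∘ₗ 𝔬.G1 U ∘ₗ 𝔬.Qstar U)
      (fun y y' => (Bx + θH * (B₃ * (1 - θ * c)⁻¹) * c) * Real.exp (-((ρ' + σ) * g.dist y y'))) :=
    hasMaj_left_rightR hG hrow hθH hBx hA₃ (by linarith) (by linarith) (by linarith) (by linarith) hKE hpQs hGQ hfix1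
  have hK₂ : 0 ≤ B₃ * (B₃ * (B₀ * (1 - θ * c)⁻¹) * c) * c := mul_nonneg (mul_nonneg hB₃ hK₁) hc
  have hC : HasMaj (cNormR R₀ H₀ 𝔬.blkY hG.lenle 0) bout
      ((E ∘ₗ 𝔬.G1 U ∘ₗ 𝔬.Qstar U) ∘ₗ (𝔬.C1 U ∘ₗ (𝔬.Q U ∘ₗ (𝔬.G1 U ∘ₗ 𝔬.Dstar U))))
      (fun y y' => (cNormR R₀ H₀ 𝔬.blkZ hG.lenle 1 (X := Z)).κ * (Bx + θH * (B₃ * (1 - θ * c)⁻¹) * c) *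
        (B₃ * (B₃ * (B₀ * (1 - θ * c)⁻¹) * c) * c) * c * Real.exp (-(ρ' * g.dist y y'))) :=
    hasMaj_comp_exp htri hG.dnn hrow hBx' hK₂ hρ' (by linarith) le_rfl hD1Q hCQG
  simp only [cNormR_κ, one_mul] at hC
  -- (e) assembling (3.153) with E on the left and ∇* on the right
  have h := ((hD1.of_rate_le hG.dnn hCL (by linarith : ρ' ≤ ρ)).sub hB).sub hC
  rw [← E_GG_F_eq hI E (𝔬.Dstar U)] at h
  have hC0 : 0 ≤ constH313 (Bh + θH * (B₀ * (1 - θ * c)⁻¹) * c) θH (B₀ * (1 - θ * c)⁻¹) (B₃ * (1 - θ * c)⁻¹) B₃ Bx Bx 1 c :=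
    constH313_nonneg hCL hθH hA₁ hA₃ hB₃ hBx hBx zero_le_one hc
  have h2 : HasMaj (cNormR R₀ H₀ 𝔬.blkY hG.lenle 0) bout (E ∘ₗ (𝔬.GG U ∘ₗ 𝔬.Dstar U))
      (fun a b => constH313 (Bh + θH * (B₀ * (1 - θ * c)⁻¹) * c) θH (B₀ * (1 - θ * c)⁻¹) (B₃ * (1 - θ * c)⁻¹) B₃ Bx Bx 1 c *
        Real.exp (-(ρ' * g.dist a b))) :=
    h.mono fun a b => le_of_eq (by simp only [constH313, toB6_dist]; ring)
  have h' := hasMajorantHom_of_hasMaj_cNormR hG (fun a b => mul_nonneg hC0 (Real.exp_nonneg _)) h2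
  have h'' : HasMajorantHom (g := toB6 g R₀ H₀) 𝔬.blkY 𝔭.blkPX (𝔭.ΦX U β ∘ₗ (𝔬.GG U ∘ₗ 𝔬.Dstar U))
      (fun (a b : g.Site) => constH313 (Bh + θH * (B₀ * (1 - θ * c)⁻¹) * c) θH (B₀ * (1 - θ * c)⁻¹) (B₃ * (1 - θ * c)⁻¹) B₃ Bx Bx 1 c *
        Real.exp (-(ρ' * g.dist a b)) * g.len a ^ (-(β - 1)) * g.len b ^ (0 : ℝ)) := h'
  refine hasMajorantHom_mono (g := toB6 g R₀ H₀) 𝔬.blkY 𝔭.blkPX h'' fun a b => le_of_eq ?_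
  simp only [Real.rpow_zero, mul_one, show -(β - 1) = 1 - β by ring]
  ring

end OneMember

end

end Literature.MathematicalPhysics.QuantumFieldTheory.Balaban1983to89.B9Thm313WholeHolder
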